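import Summits.QuantumFields.YangMills.Theorems.UnitScaleTiltFluctuationComparisonRegPrAnsatzTRowBound
import Literature.MathematicalPhysics.QuantumFieldTheory.Balaban1983to89.T3SmallLiftHistory
import Literature.MathematicalPhysics.QuantumFieldTheory.Balaban1983to89.T3NestedUnitLaws
import Literature.MathematicalPhysics.QuantumFieldTheory.Balaban1983to89.T3MinimiserStabilityReduction
import HarnessLib

/-!
# Crux `FluctuationComparisonRegPrIntL` (stmt-QuantumFields-20520, rung R3), (A)-package road B1–B4 of LEAD w3 g22 (2026-08-30T17:42Z), item **(B4)
# «SPREAD LIFT»** — ITS GEOMETRIC CORE IS THE STUB-1 SMALL-LIFT MACHINERY BY NAME: every `θ_j`-small coarse datum `V` has a point of its `descend`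
# fibre inside the finer `c·θ_{j+1}`-window, for every gain `κ√L ≤ c` the tree's one-step small lifts deliver; for odd `L ≥ 9`, `c = ¾` is reached

Cell `ym3-torus` (HUMAN RULING D-0037, YM ladder rung R3 — SU(2) YM₃ on T³: NOT d = 4, NOT infinite volume, NOT a mass gap, NOT Clay).  Width seat `ym3-torus-px12`
(gen 19; p1 lineage — the sources are ym3-torus-p1 g9–g11's UV3-NODE §18–§20 files and the fleet's STUB-1 closure).  THEOREMS ONLY (0 `def`, 0 `sorry`, default
heartbeats); `--supports stmt-QuantumFields-20520 --as helper`; count-neutral; NO claim on crux ∕ stub ∕ registry; `Lines/semiclassical_s2beta.lean` v11.4 untouched.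

WHY.  The fibred-chart BRIDGE ✓`OrganTangentFibredChartBridge.regularPackage_of_fibredChart` (w3 g22, p781961) displays (C3) `hmass`: for every coarse `V`
with `PlaqSmall θ_j V` (`θ_i = θBal F.L γ b₀ p₀ i`) the chart fibre meets `{PlaqSmall (¾θ_{j+1})}` with positive mass.  Its GEOMETRIC input is a SPREAD LIFT:
a fine `U` with `descend F ℰp j U = V` EXACTLY and `PlaqSmall (¾θ_{j+1}) U`.  Since `θ_{j+1}∕θ_j ≥ L^{−1∕2}` exactly (✓`T3SmallLiftHistory.sqrt_inv_mul_θBal_le_succ`),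
this is a ONE-STEP SMALL LIFT WITH GAIN `κ`, `κ√L ≤ ¾` — the object of `T3SmallLiftHistory.SmallLiftStep` ∕ `OneStepSmallLift` (EXACT (0.4) lifts; exactness
is free by ✓`BlockAvgCorrector`, ✓`ApproxLift.oneStepSmallLift_of_approx`), whose registered face ✓`IntLStub1.stub_oneStepSmallLift` records only `κ√L ≤ 1`.
THIS FILE: (§1) reads a one-step lift across runs through `descend = fieldShift ∘ blockAvg₀`; (§2) the threshold arithmetic for a gain `κ√L ≤ c`; (§3) the
window form «`θ_j`-small ⟹ a `descend`-preimage `c·θ_{j+1}`-small» from `OneStepSmallLift F ℰp κ δ₀`, `κ√L ≤ c`, above the radius floor `θ_j ≤ δ₀`; (§4) the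
`c`-versions of p1 g11's interior assembly and of the «exactness is free» packaging (gain `< c` in, `≤ c` out); (§5) ANSATZ T's table `kzT` (`λ = 18∕L²`) beats
`¾L^{−1∕2}` from `L = 9` on (`18·L^{−3∕2} < ¾ ⟺ 576 < L³`), hence ★★★`exists_oneStepSmallLift_lt_threeQuarters` (STRICT, midpoint target) ∕ `…_threeQuarters` and ★★★★`spreadLift_lt_threeQuarters` (some `c < ¾`) ∕
`spreadLift_threeQuarters`: (B4)'s geometric core BY KERNEL for every odd `L ≥ 9`.  NOT covered: `L ∈ {5, 7}` (packaged gains `0.860`, `0.972∕0.805` > ¾; the dual-Whitney kernel ✓`DualWhitney3D.norm_R2_le`,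
`8L⁴∕(L²+1)³·√L = 0.635, 0.41`, is landed as linear algebra but not yet pushed through the interior pipeline) and `L = 3` (every known kernel: `κ√3 ≥ 0.948`).

HONEST SCOPE.  Reductions and arithmetic over landed theorems; (C3) itself (chart surjectivity onto the fibre, `J > 0`, the `τ`-neighbourhood) is NOT proved; (A), COAREA∘,
VER∘, O1, crux 20520, `YM3TorusSU2` NOT proved; nothing continuum ∕ OS ∕ Clay; the Yang–Mills mass gap is NOT proved.

References: T. Bałaban, CMP **109** (1987) 249–301 [Balaban1987RG1] ((0.4) p.253, (0.18) p.255); CMP **102** (1985) 255–275 [Balaban1985UV3] ((3) p.256, (7) p.257).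
-/

set_option autoImplicit false

noncomputable section

open scoped BigOperators Matrix.Norms.L2Operator

namespace Summit.QuantumFields.YangMills.Theorems.SpreadLiftOfSmallLift

open Literature.MathematicalPhysics.QuantumFieldTheory.Balaban1983to89
open Literature.MathematicalPhysics.QuantumFieldTheory.Balaban1983to89.T3ContinuumYM3Torus
open Literature.MathematicalPhysics.QuantumFieldTheory.Balaban1983to89.T3LevelShift
open Literature.MathematicalPhysics.QuantumFieldTheory.Balaban1983to89.T3NestedUnitLaws (descend sitesPerDir_descend)
open Literature.MathematicalPhysics.QuantumFieldTheory.Balaban1983to89.T3UnitLawDensityEML (ℰp)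
open Literature.MathematicalPhysics.QuantumFieldTheory.Balaban1983to89.T3UnitScaleTilt (θBal)
open Literature.MathematicalPhysics.QuantumFieldTheory.Balaban1983to89.T3SmallLiftHistory (SmallLiftStep OneStepSmallLift sqrt_inv_mul_θBal_le_succ)
open Literature.MathematicalPhysics.QuantumFieldTheory.Balaban1983to89.T3MinimiserStabilityReduction (θBal_pos)
open T4Continuum BlockAveraging
open Summit.QuantumFields.YangMills.Theorems.ApproxLift
open Summit.QuantumFields.YangMills.Theorems.MiddleBondRepair (rhoU rhoU_pos)

/-! ## §1 A one-step small lift read across runs: `descend F ℰ j = fieldShift ∘ blockAvg₀` -/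

section Descend

variable (F : T3Family) {G : Type*} [GaugeGroup G] (ℰ : LoopAverage G)

/-- ★ **ONE-STEP SMALL LIFT ⟹ `descend`-PREIMAGE IN THE SMALLER WINDOW.**  If run `j+1` admits one-step (0.4) lifts at its level `0` with gain `κ` at
radius `δ` (`SmallLiftStep (F.P (j+1)) 0 ℰ κ δ`), then every `δ`-small `V` on run `j`'s finest lattice is `descend F ℰ j U` for a `κδ`-small `U` on
run `(j+1)`'s finest lattice (the datum is read one level up by `fieldShift`, plaquettes correspond: `plaqHol_fieldShift`). [cite: Balaban1987RG1, (0.4) p.253, (0.18) p.255] -/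
theorem exists_descend_eq_small_of_smallLiftStep {j : ℕ} {κ δ : ℝ} (h : SmallLiftStep (F.P (j + 1)) 0 ℰ κ δ)
    (V : GaugeField (F.P j) 0 G) (hV : PlaqSmall δ V) :
    ∃ U : GaugeField (F.P (j + 1)) 0 G, descend F ℰ j U = V ∧ PlaqSmall (κ * δ) U := by
  -- the datum read on level `1` of run `j+1`
  have hW : PlaqSmall δ (fieldShift (sitesPerDir_descend F j 0).symm V) := fun p => by
    rw [plaqHol_fieldShift]; exact hV _
  obtain ⟨U, hU, hUs⟩ := h _ hW
  refine ⟨U, ?_, hUs⟩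
  show fieldShift (sitesPerDir_descend F j 0) ((BlockAveraging.blockAvg (P := F.P (j + 1)) (j := 0) ℰ).avg U) = V
  rw [hU, fieldShift_symm_fieldShift]

/-- ★★ **THE FAMILY FORM.**  `OneStepSmallLift F ℰ κ δ₀` ⟹ for every `j` and every radius `0 < δ ≤ δ₀`: every `δ`-small `V` on run `j`'s finest lattice has a
`descend`-preimage on run `(j+1)`'s finest lattice that is `κδ`-small. [cite: Balaban1987RG1, (0.4) p.253, (0.18) p.255] -/
theorem spreadLift_of_oneStepSmallLift {κ δ₀ : ℝ} (h : OneStepSmallLift F ℰ κ δ₀) (j : ℕ) {δ : ℝ} (hδ : 0 < δ) (hδ₀ : δ ≤ δ₀)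
    (V : GaugeField (F.P j) 0 G) (hV : PlaqSmall δ V) :
    ∃ U : GaugeField (F.P (j + 1)) 0 G, descend F ℰ j U = V ∧ PlaqSmall (κ * δ) U :=
  exists_descend_eq_small_of_smallLiftStep F ℰ
    (h (j + 1) 0 (by show 0 + 1 ≤ F.m + (j + 1); omega) δ hδ hδ₀) V hV

end Descend

/-! ## §2 Threshold arithmetic: a gain `κ√L ≤ c` beats `c` times the threshold ratio -/

section Ratio

variable {L : ℕ} {γ b₀ p₀ : ℝ}

/-- ★ **`κ·θ(i) ≤ c·θ(i+1)` for `κ√L ≤ c`** (`0 ≤ c`, `0 < γ ≤ 1`, `b₀, p₀ ≥ 0`, `1 ≤ L`): `θ(i+1) ≥ L^{−1∕2}θ(i)` (✓`sqrt_inv_mul_θBal_le_succ`) and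
`κ ≤ c·L^{−1∕2}`. [cite: Balaban1985UV3, (3) p.256 and (7) p.257] -/
theorem mul_θBal_le_mul_θBal_succ_of_gain (hL : 1 ≤ L) (hγ : 0 < γ) (hγ1 : γ ≤ 1) (hb : 0 ≤ b₀) (hp : 0 ≤ p₀) {κ c : ℝ} (hc : 0 ≤ c)
    (hκ : κ * Real.sqrt L ≤ c) (i : ℕ) : κ * θBal L γ b₀ p₀ i ≤ c * θBal L γ b₀ p₀ (i + 1) := by
  have hL0 : (0 : ℝ) < L := by exact_mod_cast hL
  have hsL : 0 < Real.sqrt (L : ℝ) := Real.sqrt_pos.mpr hL0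
  have hθ : 0 ≤ θBal L γ b₀ p₀ i := by
    rw [T3Thresholds.θBal_eq]
    exact mul_nonneg (Real.sqrt_nonneg _) (by unfold B10.pFun; exact mul_nonneg hb (Real.rpow_nonneg (by
      have : 0 ≤ Real.log (Real.sqrt (γ * ((L : ℝ)⁻¹) ^ i))⁻¹ :=
        Real.log_nonneg ((one_le_inv₀ (T3ThresholdSmallness.sqrt_coupling_pos_le hL hγ i).1).mpr
          (T3Thresholds.coupling_le_one hL hγ hγ1 i))
      linarith) _))
  have hκ' : κ ≤ c * Real.sqrt ((L : ℝ)⁻¹) := by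
    rw [Real.sqrt_inv, ← div_eq_mul_inv, le_div_iff₀ hsL]; exact hκ
  have hstep := sqrt_inv_mul_θBal_le_succ (b₀ := b₀) (p₀ := p₀) hL hγ hγ1 hb hp i
  calc κ * θBal L γ b₀ p₀ i ≤ c * Real.sqrt ((L : ℝ)⁻¹) * θBal L γ b₀ p₀ i := mul_le_mul_of_nonneg_right hκ' hθ
    _ = c * (Real.sqrt ((L : ℝ)⁻¹) * θBal L γ b₀ p₀ i) := by ring
    _ ≤ c * θBal L γ b₀ p₀ (i + 1) := mul_le_mul_of_nonneg_left hstep hc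

end Ratio

/-! ## §3 The window form: `θ_j`-small data have `descend`-preimages in the `c·θ_{j+1}`-window -/

section Window

variable (F : T3Family)

/-- ★★★ **SPREAD LIFT INTO THE `c·θ_{j+1}`-WINDOW FROM A ONE-STEP SMALL LIFT WITH GAIN `κ√L ≤ c`.**  Under `OneStepSmallLift F ℰp κ δ₀` and `κ√(F.L) ≤ c`
(`0 ≤ c`; `0 < γ ≤ 1`, `0 < b₀`, `0 ≤ p₀`), at every run index `j` whose threshold is below the lift's radius floor, `θ_j ≤ δ₀`: every `θ_j`-small `V` on run `j`'s
finest lattice is `descend F ℰp j U` for a `U` with `PlaqSmall (c·θ_{j+1}) U`.  (`θ_j ↓ 0` in `j` for fixed `γ ≤ 1`, so the floor holds EVENTUALLY in `j` — the same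
quantifier shape as MIN∘'s `∃ j₁ ∀ j ≥ j₁`.) [cite: Balaban1987RG1, (0.4) p.253, (0.18) p.255; Balaban1985UV3, (7) p.257] -/
theorem spreadLift_window {κ δ₀ c : ℝ} (h : OneStepSmallLift F ℰp κ δ₀) (hc : 0 ≤ c) (hκ : κ * Real.sqrt F.L ≤ c)
    {γ b₀ p₀ : ℝ} (hγ : 0 < γ) (hγ1 : γ ≤ 1) (hb : 0 < b₀) (hp : 0 ≤ p₀)
    (j : ℕ) (hj : θBal F.L γ b₀ p₀ j ≤ δ₀)
    (V : GaugeField (F.P j) 0 (Matrix.specialUnitaryGroup (Fin 2) ℂ)) (hV : PlaqSmall (θBal F.L γ b₀ p₀ j) V) :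
    ∃ U : GaugeField (F.P (j + 1)) 0 (Matrix.specialUnitaryGroup (Fin 2) ℂ),
      descend F ℰp j U = V ∧ PlaqSmall (c * θBal F.L γ b₀ p₀ (j + 1)) U := by
  have hL : 1 ≤ F.L := le_of_lt F.hL.2
  obtain ⟨U, hU, hUs⟩ := spreadLift_of_oneStepSmallLift F ℰp h j (θBal_pos hL hγ hγ1 hb p₀ j) hj V hV
  exact ⟨U, hU, fun p => (hUs p).trans_le (mul_θBal_le_mul_θBal_succ_of_gain hL hγ hγ1 hb.le hp hc hκ j)⟩

end Window

/-! ## §4 Packaging with a prescribed gain `c`: the `c`-versions of the interior assembly and of «exactness is free» -/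

section Packaging

/-- **p1 g11's INTERIOR ASSEMBLY WITH GAIN `< c`** (= ✓`exists_approxSmallLift_of_kernel_lineNeutral` with `1 ↦ c`): a line-neutral kernel table with row mass `K₁`,
row bound `(λ, β)` and `λ√L < c` gives `ApproxSmallLift F κ₀ C δ₀` for every family of block size `L` with `κ₀√L < c` — the radius `δ₀` is shrunk until
`(λ + (C_q+1)δ₀)√L < c`, through ✓`approxSmallLift_of_kernel_lineNeutral` (gain `λ + (C_q+1)δ₀` at ANY small radius). [cite: Balaban1987RG1, (0.4) p.253] -/
theorem exists_approxSmallLift_of_kernel_lineNeutral_gain (L : ℕ) (R : ℕ)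
    (tab : (F : T3Family) → Fin 3 → (Fin 3 → Fin F.L) → Orient 3 → (Fin 3 → Fin (2 * R + 1)) → ℝ)
    {K₁ lam β Cq₀ Ca₀ c : ℝ} (hK0 : 0 ≤ K₁) (hlam : 0 ≤ lam) (hβ : 0 ≤ β) (hgain : lam * Real.sqrt L < c) (hCq₀ : 0 ≤ Cq₀) (hCa₀ : 0 ≤ Ca₀)
    (h : ∀ F : T3Family, F.L = L → (Cq (F.P 0) R lam β K₁ ≤ Cq₀) ∧ (Ca (F.P 0) R K₁ ≤ Ca₀) ∧ ∀ K,
      LineNeutral (P := F.P K) (n := Fin 2) R (tab F) ∧ RowMass (P := F.P K) R (tab F) K₁ ∧ RowBound (P := F.P K) (Fin 2) R (tab F) lam β) :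
    ∃ κ₀ C δ₀ : ℝ, 0 ≤ κ₀ ∧ κ₀ * Real.sqrt L < c ∧ 0 ≤ C ∧ 0 < δ₀ ∧ ∀ F : T3Family, F.L = L → ApproxSmallLift F κ₀ C δ₀ := by
  set sL : ℝ := Real.sqrt L with hsL
  have hsL0 : 0 ≤ sL := Real.sqrt_nonneg _
  have hgap : 0 < c - lam * sL := by linarith
  -- the radius
  set A : ℝ := 320 * ((6 * L : ℕ) : ℝ) * K₁ + 1 with hA_def
  have hA : 0 < A := by positivity
  set δ₀ : ℝ := min (min (1 / 3) (1 / A)) ((c - lam * sL) / (2 * ((Cq₀ + 1) * sL + 1))) with hδ₀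
  have hB : 0 < 2 * ((Cq₀ + 1) * sL + 1) := by positivity
  have hδ₀pos : 0 < δ₀ := lt_min (lt_min (by norm_num) (by positivity)) (div_pos hgap hB)
  have hδ₀3 : δ₀ ≤ 1 / 3 := (min_le_left _ _).trans (min_le_left _ _)
  have hδ₀A : δ₀ ≤ 1 / A := (min_le_left _ _).trans (min_le_right _ _)
  have hδ₀g : δ₀ ≤ (c - lam * sL) / (2 * ((Cq₀ + 1) * sL + 1)) := min_le_right _ _
  have hKδ₀ : 320 * ((6 * L : ℕ) : ℝ) * K₁ * δ₀ ≤ 1 := by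
    have h1 := (le_div_iff₀ hA).mp hδ₀A
    rw [hA_def] at h1
    nlinarith [mul_nonneg (mul_nonneg (by positivity : (0 : ℝ) ≤ 320 * ((6 * L : ℕ) : ℝ)) hK0) hδ₀pos.le]
  refine ⟨lam + (Cq₀ + 1) * δ₀, Ca₀, δ₀, by positivity, ?_, hCa₀, hδ₀pos, fun F hFL => ?_⟩
  · have := (le_div_iff₀ hB).mp hδ₀g
    nlinarith
  · obtain ⟨hC, hCa, hK⟩ := h F hFL
    have hm : 320 * (legLen (F.P 0) : ℝ) * K₁ * δ₀ ≤ 1 := by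
      rw [legLen_family, hFL]; exact hKδ₀
    have happ := approxSmallLift_of_kernel_lineNeutral F (tab F) hK hK0 hlam hβ hδ₀3 hm
    intro K j hj δ hδ hδδ₀ V hV
    obtain ⟨U, hU, hacc⟩ := happ K j hj δ hδ hδδ₀ V hV
    refine ⟨U, fun p => (hU p).trans_le ?_, fun c' => (hacc c').trans ?_⟩
    · have : (lam + (Cq (F.P 0) R lam β K₁ + 1) * δ₀) ≤ lam + (Cq₀ + 1) * δ₀ := by nlinarith
      exact mul_le_mul_of_nonneg_right this hδ.le
    · exact mul_le_mul_of_nonneg_right hCa (sq_nonneg _)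

/-- **«EXACTNESS IS FREE» WITH GAIN `≤ c`** (= ✓`ApproxLift.oneStepSmallLift_stub_of_approx` with `1 ↦ c`, one block size): approximate small lifts with
`κ₀√L < c` for every family of block size `L` give EXACT one-step small lifts `OneStepSmallLift F ℰp κ δ₁` with `κ√L ≤ c`, through
✓`ApproxLift.oneStepSmallLift_of_approx` (gain `κ₀ + 8·|I|·C·δ₁`, radius `δ₁` shrunk accordingly). [cite: Balaban1987RG1, (0.4) p.253] -/
theorem exists_oneStepSmallLift_of_approx_gain (L : ℕ) {c : ℝ}
    (h : ∃ κ₀ C δ₀ : ℝ, 0 ≤ κ₀ ∧ κ₀ * Real.sqrt L < c ∧ 0 ≤ C ∧ 0 < δ₀ ∧ ∀ F : T3Family, F.L = L → ApproxSmallLift F κ₀ C δ₀) :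
    ∃ κ δ₁ : ℝ, κ * Real.sqrt L ≤ c ∧ 0 < δ₁ ∧ ∀ F : T3Family, F.L = L → OneStepSmallLift F ℰp κ δ₁ := by
  obtain ⟨κ₀, C, δ₀, hκ₀, hκL, hC, hδ₀, hF⟩ := h
  set n : ℕ := 36 * L ^ 3 with hn_def
  set ρ : ℝ := rhoU n with hρ_def
  have hρ : 0 < ρ := rhoU_pos n
  set sL : ℝ := Real.sqrt L with hsL
  have hsL0 : 0 ≤ sL := Real.sqrt_nonneg _
  have hgap : 0 < c - κ₀ * sL := by linarith
  set A₁ : ℝ := (((5 * L : ℕ) : ℝ)) ^ 2 / 4 * κ₀ + 1 with hA₁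
  set A₂ : ℝ := 2 * (n : ℝ) * C + 1 with hA₂
  set A₃ : ℝ := 8 * (n : ℝ) * C * sL + 1 with hA₃
  have hA₁pos : 0 < A₁ := by positivity
  have hA₂pos : 0 < A₂ := by positivity
  have hA₃pos : 0 < A₃ := by positivity
  set δ₁ : ℝ := min (min δ₀ 1) (min (min (ρ / A₁) (ρ / A₂)) ((c - κ₀ * sL) / A₃)) with hδ₁_def
  have hδ₁pos : 0 < δ₁ := by positivity
  have hδ₁₀ : δ₁ ≤ δ₀ := (min_le_left _ _).trans (min_le_left _ _)
  have hδ₁1 : δ₁ ≤ 1 := (min_le_left _ _).trans (min_le_right _ _)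
  have hδ₁A₁ : δ₁ ≤ ρ / A₁ := (min_le_right _ _).trans ((min_le_left _ _).trans (min_le_left _ _))
  have hδ₁A₂ : δ₁ ≤ ρ / A₂ := (min_le_right _ _).trans ((min_le_left _ _).trans (min_le_right _ _))
  have hδ₁A₃ : δ₁ ≤ (c - κ₀ * sL) / A₃ := (min_le_right _ _).trans (min_le_right _ _)
  refine ⟨κ₀ + 8 * (n : ℝ) * C * δ₁, δ₁, ?_, hδ₁pos, fun F hFL => ?_⟩
  · have h1 : 8 * (n : ℝ) * C * δ₁ * sL ≤ c - κ₀ * sL := by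
      have := (le_div_iff₀ hA₃pos).mp hδ₁A₃
      nlinarith [this, hδ₁pos.le, hsL0, hC]
    nlinarith [h1]
  · subst hFL
    have hn' : (36 * F.L ^ 3 : ℕ) = n := rfl
    have h1 : (((5 * F.L : ℕ) : ℝ)) ^ 2 / 4 * (κ₀ * δ₁) ≤ rhoU (36 * F.L ^ 3) := by
      rw [hn']
      have := (le_div_iff₀ hA₁pos).mp hδ₁A₁
      nlinarith [this, hδ₁pos.le, hκ₀]
    have h2 : C * δ₁ ≤ rhoU (36 * F.L ^ 3) / (2 * (36 * F.L ^ 3 : ℕ)) := by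
      rw [hn']
      have hn0 : (0 : ℝ) < n := by
        rw [hn_def]; have := F.hL.2; positivity
      have := (le_div_iff₀ hA₂pos).mp hδ₁A₂
      rw [le_div_iff₀ (by positivity)]
      nlinarith [this, hδ₁pos.le, hC]
    have h3 := oneStepSmallLift_of_approx F hκ₀ hC hδ₁pos hδ₁₀ hδ₁1 h1 h2 (hF F rfl)
    rw [hn'] at h3
    exact h3

end Packaging

/-! ## §5 ANSATZ T reaches `¾` from `L = 9` on; (B4)'s geometric core for every odd `L ≥ 9` -/

section ThreeQuarters

/-- **`18·L^{−3∕2} < ¾` for `L ≥ 9`** (`⟺ √L < L²∕24 ⟸ 576 < L³`; `L = 9`: `729`). [folklore] -/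
theorem gainT_lt_threeQuarters {L : ℕ} (h9 : 9 ≤ L) : 18 / (L : ℝ) ^ 2 * Real.sqrt L < 3 / 4 := by
  have hL : (9 : ℝ) ≤ L := by exact_mod_cast h9
  have hL0 : (0 : ℝ) < L := by linarith
  have hsq : Real.sqrt (L : ℝ) < (L : ℝ) ^ 2 / 24 := by
    rw [Real.sqrt_lt' (by positivity)]
    nlinarith [mul_le_mul hL hL (by norm_num) hL0.le, mul_le_mul hL (mul_le_mul hL hL (by norm_num) hL0.le) (by norm_num) hL0.le]
  calc 18 / (L : ℝ) ^ 2 * Real.sqrt L < 18 / (L : ℝ) ^ 2 * ((L : ℝ) ^ 2 / 24) := mul_lt_mul_of_pos_left hsq (by positivity)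
    _ = 3 / 4 := by field_simp; ring

/-- ★★★ **ONE-STEP SMALL LIFTS WITH GAIN STRICTLY INSIDE `¾` FOR EVERY ODD `L ≥ 9`** — ANSATZ T's table `kzT` (`K₁ = 162`, `λ = 18∕L²`, `β = 1`;
✓`AnsatzT.rowBound_T`, ✓`sliceNeutral_T` ⟹ ✓`lineNeutral_of_sliceNeutral`, ✓`rowMass_T`) through §4 at the midpoint `c := (18L^{−3∕2} + ¾)∕2 < ¾` (STRICT: the
consumer's open-set positivity wants the lift in the INTERIOR of the `¾`-window, LEAD w3 g22 18:42Z). [cite: Balaban1987RG1, (0.4) p.253, (0.18) p.255] -/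
theorem exists_oneStepSmallLift_lt_threeQuarters {L : ℕ} (hodd : Odd L) (h9 : 9 ≤ L) :
    ∃ κ δ₀ : ℝ, κ * Real.sqrt L < 3 / 4 ∧ 0 < δ₀ ∧ ∀ F : T3Family, F.L = L → OneStepSmallLift F ℰp κ δ₀ := by
  have hL' : Odd L ∧ 1 < L := ⟨hodd, by omega⟩
  have hlam : (0 : ℝ) ≤ 18 / (L : ℝ) ^ 2 := by positivity
  have hK : (0 : ℝ) ≤ 162 := by norm_num
  have hg := gainT_lt_threeQuarters h9
  -- the midpoint gain target, strictly between ANSATZ T's `18L^{−3∕2}` and `¾`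
  set c : ℝ := (18 / (L : ℝ) ^ 2 * Real.sqrt L + 3 / 4) / 2 with hc_def
  have hc1 : 18 / (L : ℝ) ^ 2 * Real.sqrt L < c := by rw [hc_def]; linarith
  have hc2 : c < 3 / 4 := by rw [hc_def]; linarith
  have happ : ∃ κ₀ C δ₀ : ℝ, 0 ≤ κ₀ ∧ κ₀ * Real.sqrt L < c ∧ 0 ≤ C ∧ 0 < δ₀ ∧
      ∀ F : T3Family, F.L = L → ApproxSmallLift F κ₀ C δ₀ := by
    refine exists_approxSmallLift_of_kernel_lineNeutral_gain L 1 (fun F => AnsatzT.kzT F.L) (K₁ := 162) (lam := 18 / (L : ℝ) ^ 2) (β := 1)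
      (Cq₀ := Cq (AnsatzS.P3 L 1 0 hL') 1 (18 / (L : ℝ) ^ 2) 1 162) (Ca₀ := Ca (AnsatzS.P3 L 1 0 hL') 1 162)
      hK hlam zero_le_one hc1 (Cq_nonneg _ _ hlam zero_le_one hK) (Ca_nonneg _ _ hK) fun F hFL => ⟨?_, ?_, fun K => ?_⟩
    · obtain ⟨L', hL'', m, hm⟩ := F
      cases hFL
      exact le_of_eq rfl
    · obtain ⟨L', hL'', m, hm⟩ := F
      cases hFL
      exact le_of_eq rfl
    · have hF3 : 3 ≤ F.L := by rw [hFL]; omega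
      have hRB := AnsatzT.rowBound_T (m := F.m) (K := K) (hL := F.hL) (n := Fin 2) F.hL.1 hF3
      have hcst : (18 / (F.L : ℝ) ^ 2) = 18 / (L : ℝ) ^ 2 := by rw [hFL]
      rw [hcst] at hRB
      exact ⟨lineNeutral_of_sliceNeutral (AnsatzT.sliceNeutral_T (m := F.m) (K := K) (hL := F.hL) F.hL.1),
        AnsatzT.rowMass_T (m := F.m) (K := K) (hL := F.hL) F.hL.1 hF3, hRB⟩
  obtain ⟨κ, δ₀, hκ, hδ₀, hF⟩ := exists_oneStepSmallLift_of_approx_gain L happ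
  exact ⟨κ, δ₀, hκ.trans_lt hc2, hδ₀, hF⟩

/-- ★★★ **… hence with gain `κ√L ≤ ¾`.** [cite: Balaban1987RG1, (0.4) p.253, (0.18) p.255] -/
theorem exists_oneStepSmallLift_threeQuarters {L : ℕ} (hodd : Odd L) (h9 : 9 ≤ L) :
    ∃ κ δ₀ : ℝ, κ * Real.sqrt L ≤ 3 / 4 ∧ 0 < δ₀ ∧ ∀ F : T3Family, F.L = L → OneStepSmallLift F ℰp κ δ₀ := by
  obtain ⟨κ, δ₀, hκ, hδ₀, hF⟩ := exists_oneStepSmallLift_lt_threeQuarters hodd h9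
  exact ⟨κ, δ₀, hκ.le, hδ₀, hF⟩

/-- ★★★★ **(B4)'s GEOMETRIC CORE FOR EVERY ODD `L ≥ 9`, STRICT FORM: A `descend`-PREIMAGE IN THE `c·θ_{j+1}`-WINDOW FOR SOME `c < ¾`.**  For odd `L ≥ 9` there
are `c < ¾` and `δ₀ > 0` such that for every family of block size `L`, every `0 < γ ≤ 1`, `0 < b₀`, `0 ≤ p₀` and every run index `j` with `θ_j ≤ δ₀`: every `V`
with `PlaqSmall θ_j V` is `descend F ℰp j U` for some `U` with `PlaqSmall (c·θ_{j+1}) U` — strictly inside the `¾θ_{j+1}`-window (`θ_i = θBal L γ b₀ p₀ i`).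
[cite: Balaban1987RG1, (0.4) p.253, (0.18) p.255; Balaban1985UV3, (3) p.256 and (7) p.257] -/
theorem spreadLift_lt_threeQuarters {L : ℕ} (hodd : Odd L) (h9 : 9 ≤ L) :
    ∃ c δ₀ : ℝ, 0 ≤ c ∧ c < 3 / 4 ∧ 0 < δ₀ ∧ ∀ F : T3Family, F.L = L → ∀ (γ b₀ p₀ : ℝ), 0 < γ → γ ≤ 1 → 0 < b₀ → 0 ≤ p₀ →
      ∀ j : ℕ, θBal F.L γ b₀ p₀ j ≤ δ₀ →
        ∀ V : GaugeField (F.P j) 0 (Matrix.specialUnitaryGroup (Fin 2) ℂ), PlaqSmall (θBal F.L γ b₀ p₀ j) V →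
          ∃ U : GaugeField (F.P (j + 1)) 0 (Matrix.specialUnitaryGroup (Fin 2) ℂ),
            descend F ℰp j U = V ∧ PlaqSmall (c * θBal F.L γ b₀ p₀ (j + 1)) U := by
  obtain ⟨κ, δ₀, hκ, hδ₀, hF⟩ := exists_oneStepSmallLift_lt_threeQuarters hodd h9
  have hL0 : (0 : ℝ) < Real.sqrt L := Real.sqrt_pos.mpr (by exact_mod_cast (show 0 < L by omega))
  -- the gain actually achieved, clipped below at `0`
  refine ⟨max (κ * Real.sqrt L) 0, δ₀, le_max_right _ _, max_lt hκ (by norm_num), hδ₀,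
    fun F hFL γ b₀ p₀ hγ hγ1 hb hp j hj V hV => ?_⟩
  exact spreadLift_window F (hF F hFL) (le_max_right _ _) (by rw [hFL]; exact le_max_left _ _) hγ hγ1 hb hp j hj V hV

/-- ★★★★ **(B4)'s GEOMETRIC CORE FOR EVERY ODD `L ≥ 9`: THE `¾θ_{j+1}`-WINDOW MEETS EVERY `descend`-FIBRE OVER THE `θ_j`-WINDOW, ABOVE THE RADIUS FLOOR.**
For odd `L ≥ 9` there is `δ₀ > 0` such that for every family of block size `L`, every `0 < γ ≤ 1`, `0 < b₀`, `0 ≤ p₀` and every run index `j` with `θ_j ≤ δ₀`: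
every `V` with `PlaqSmall θ_j V` is `descend F ℰp j U` for some `U` with `PlaqSmall (¾θ_{j+1}) U` (`θ_i = θBal L γ b₀ p₀ i`). [cite: Balaban1987RG1, (0.4) p.253, (0.18) p.255; Balaban1985UV3, (3) p.256 and (7) p.257] -/
theorem spreadLift_threeQuarters {L : ℕ} (hodd : Odd L) (h9 : 9 ≤ L) :
    ∃ δ₀ : ℝ, 0 < δ₀ ∧ ∀ F : T3Family, F.L = L → ∀ (γ b₀ p₀ : ℝ), 0 < γ → γ ≤ 1 → 0 < b₀ → 0 ≤ p₀ →
      ∀ j : ℕ, θBal F.L γ b₀ p₀ j ≤ δ₀ →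
        ∀ V : GaugeField (F.P j) 0 (Matrix.specialUnitaryGroup (Fin 2) ℂ), PlaqSmall (θBal F.L γ b₀ p₀ j) V →
          ∃ U : GaugeField (F.P (j + 1)) 0 (Matrix.specialUnitaryGroup (Fin 2) ℂ),
            descend F ℰp j U = V ∧ PlaqSmall (3 / 4 * θBal F.L γ b₀ p₀ (j + 1)) U := by
  obtain ⟨κ, δ₀, hκ, hδ₀, hF⟩ := exists_oneStepSmallLift_threeQuarters hodd h9
  refine ⟨δ₀, hδ₀, fun F hFL γ b₀ p₀ hγ hγ1 hb hp j hj V hV => ?_⟩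
  exact spreadLift_window F (hF F hFL) (by norm_num) (by rw [hFL]; exact hκ) hγ hγ1 hb hp j hj V hV

end ThreeQuarters

end Summit.QuantumFields.YangMills.Theorems.SpreadLiftOfSmallLift

end
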